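import Summits.ValiantsHypothesis.ValiantsHypothesis.Theses.AnyonJets
import Summits.ValiantsHypothesis.ValiantsHypothesis.Theorems.AnyonJetsConstantFreeJetGrowthDefs
import Mathlib.NumberTheory.Padics.PadicVal.Basic
import HarnessLib

/-!
# AnyonJets — crux `JetConstantElim` (stmt-ValiantsHypothesis-16737), line `birth`:
# the MULTIPLIER BYPASS — `stub_multiplierRemoval` can leave the critical path

The line `birth` proves the crux `CE = JetConstantElim` from four stubs; two are open and
conjecture-grade: `stub_integralMultiple` (near-optimal `ℚ̄`-circuits of the jets have an integral
normal form computing some multiple `M·J_(n,k)`) and `stub_multiplierRemoval` (`MR`: the multiplier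
can be removed constant-freely at polynomial cost — the "VP⁰ with integer division" problem,
Koiran–Perifel 2011 Rem. 4). This file records, sorry-free and definition-free, that the route's
assembly does not NEED the multiplier removed: an integer multiplier can be carried THROUGH the
assembly to the Boolean shadow, where it dissolves (odd part invertible modulo `2^{k+e}`, the
`2`-part only shifts bits — companion file `AnyonJetsJetConstantElimMultiplierBypassBoolean.lean`).
Concretely, with the two "ultimate" (= up to an integer multiplier, Bürgisser 2009) variants

* `CE^ult` — constant elimination UP TO A MULTIPLIER of polynomial bit-length:
  `∃ b ∀ n ∀ k ≤ log₂ n ∃ M ≥ 1, log₂ M ≤ (L_ℂ(J)+n+2)^b ∧ τ(M·J_(n,k)) ≤ (L_ℂ(J_(n,k))+n+2)^b`;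
* `CF^ult` — MULTIPLIER-ROBUST constant-free jet growth:
  `∀ c ∃ k ≥ 1 ∀ n₀ ∃ n ≥ n₀ ∀ M ≥ 1, v₂(M) ≤ n^c → n^c ≤ τ(M·J_(n,k))`,

(all statements written out inline below; `J_(n,k)` = the tree's `jet n k`, rfl-equal to the
route's `let J`) we prove:

* `closes_ultimate : CF^ult → CE^ult → UniformJetUpperBound → ValiantsHypothesis` — the same
  ℕ-arithmetic as the route's `closes` (the multiplier's `v₂ ≤ log₂ ≤ poly` is what `CF^ult` asks);
* `jetConstantElimUltimate_of` — `stub_algebraicDescent → stub_integralMultiple' →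
  stub_signSimulation → CE^ult`, where `stub_integralMultiple'` is the registered
  `stub_integralMultiple` with the single extra conjunct `Nat.log 2 M ≤ (Q.size + n + 2)^b₁` (any
  height-normal-form proof bounds `log M`; in substance the same conjecture) — NO multiplier removal;
* `jetConstantElim_of_ultimate_of_multiplierRemoval` — `CE^ult → MR → CE`: the stub `MR` is
  exactly the bridge between the two gluings; `cfGrowth_of_ultimate` — `CF^ult → CF`;
  `jetConstantElimUltimate_of_jetConstantElim` — `CE → CE^ult` (`M = 1`).

So the planner may re-glue the route as `closes_ultimate (CF^ult) (CE^ult) (U)`: the crux pair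
`{CE, CF}` becomes `{CE^ult, CF^ult}`, `CE^ult` has ONE open stub (`stub_integralMultiple'`, the
field-of-definition / height problem) instead of two, and `CF^ult` keeps the Boolean evidence chain
of `CF` (`PerModPowBooleanHard → CF^ult`, companion file). This seat files no items or routes
(D-0014); the re-glue is a planner act. Honest framing: structural bookkeeping around OPEN
conjecture-grade statements; nothing here proves `CE`, `CF`, their ultimate variants, or VP ≠ VNP.

References: P. Bürgisser, *On defining integers and proving arithmetic circuit lower bounds*,
Comput. Complexity 18 (2009), §1 ("ultimately"), Thm. 2.10; P. Koiran, S. Perifel,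
*Interpolation in Valiant's theory*, Comput. Complexity 20 (2011), Rem. 4; L. G. Valiant,
*The complexity of computing the permanent*, TCS 8 (1979), §4 (per mod `2^k`).
-/

noncomputable section

-- single-conjunct layout: Sub = Summit, duplicated namespace component intended
set_option linter.dupNamespace false

namespace Summit.ValiantsHypothesis.ValiantsHypothesis.Theorems.AnyonJets.JetConstantElim

open MvPolynomial Literature.Computability.AlgebraicComplexity
open Summit.ValiantsHypothesis.ValiantsHypothesis.Theses.AnyonJets
open Summit.ValiantsHypothesis.ValiantsHypothesis.Theorems.AnyonJets.ConstantFreeJetGrowth (jet)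

/-! ### The re-glued assembly -/

/-- `UniformJetUpperBound` with the route's `let J` replaced by the tree's `jet` (rfl). [folklore] -/
theorem uniformJetUpperBound_iff_jet :
    UniformJetUpperBound ↔ (VP ℂ = VNP ℂ → ∃ c n₀ : ℕ, ∀ n : ℕ, n₀ ≤ n → ∀ k : ℕ,
      complexity (MvPolynomial.map (Int.castRingHom ℂ) (jet n k)) ≤ n ^ c) :=
  Iff.rfl

/-- **`closes_ultimate : CF^ult → CE^ult → U → VH`** — the route's deciding arithmetic with an
integer multiplier carried along: assume `VP = VNP`; `U` gives `L_ℂ(J_(n,k)) ≤ n^c`; `CE^ult`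
gives a multiple `M·J_(n,k)` with `log₂ M, τ(M·J) ≤ (L+n+2)^b ≤ n^{(c+2)b}`; since
`v₂(M) ≤ log₂ M`, `CF^ult` at `c' = (c+2)b + 1` produces `k` and `n` with
`n^{c'} ≤ τ(M·J_(n,k)) ≤ n^{c'-1}`, absurd. [folklore] -/
theorem closes_ultimate
    (hCF : ∀ c : ℕ, ∃ k : ℕ, 1 ≤ k ∧ ∀ n₀ : ℕ, ∃ n : ℕ, n₀ ≤ n ∧ ∀ M : ℕ, 1 ≤ M →
      padicValNat 2 M ≤ n ^ c → n ^ c ≤ constantFreeComplexity ((M : ℤ) • jet n k))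
    (hCE : ∃ b : ℕ, ∀ n k : ℕ, k ≤ Nat.log 2 n → ∃ M : ℕ, 1 ≤ M ∧
      Nat.log 2 M ≤ (complexity (MvPolynomial.map (Int.castRingHom ℂ) (jet n k)) + n + 2) ^ b ∧
      constantFreeComplexity ((M : ℤ) • jet n k) ≤
        (complexity (MvPolynomial.map (Int.castRingHom ℂ) (jet n k)) + n + 2) ^ b)
    (hU : UniformJetUpperBound) : _root_.ValiantsHypothesis := by
  show Literature.Computability.AlgebraicComplexity.VP ℂ ≠ Literature.Computability.AlgebraicComplexity.VNP ℂ
  intro hEq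
  obtain ⟨c, n₀, hc⟩ := (uniformJetUpperBound_iff_jet.mp hU) hEq
  obtain ⟨b, hb⟩ := hCE
  obtain ⟨k, hk1, hk⟩ := hCF ((c + 2) * b + 1)
  obtain ⟨n, hn, hτ⟩ := hk (max n₀ (max (2 ^ k) 3))
  have hn₀ : n₀ ≤ n := le_trans (le_max_left _ _) hn
  have h2k : 2 ^ k ≤ n := le_trans (le_trans (le_max_left _ _) (le_max_right _ _)) hn
  have h3 : 3 ≤ n := le_trans (le_trans (le_max_right _ _) (le_max_right _ _)) hn
  have hklog : k ≤ Nat.log 2 n := Nat.le_log_of_pow_le (by norm_num) h2k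
  obtain ⟨M, hM, hlogM, hτM⟩ := hb n k hklog
  have hUn := hc n hn₀ k
  set L := complexity (MvPolynomial.map (Int.castRingHom ℂ) (jet n k)) with hL
  -- `L + n + 2 ≤ n^(c+2)`
  have hn1 : 1 ≤ n := by omega
  have hpow1 : n ≤ n ^ (c + 1) := by
    calc n = n ^ 1 := (pow_one n).symm
      _ ≤ n ^ (c + 1) := Nat.pow_le_pow_right hn1 (by omega)
  have hpow2 : n ^ c ≤ n ^ (c + 1) := Nat.pow_le_pow_right hn1 (by omega)
  have hsum : L + n + 2 ≤ n ^ (c + 2) := by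
    have : L + n + 2 ≤ 3 * n ^ (c + 1) := by omega
    calc L + n + 2 ≤ 3 * n ^ (c + 1) := this
      _ ≤ n * n ^ (c + 1) := Nat.mul_le_mul_right _ h3
      _ = n ^ (c + 2) := by ring
  have hXb : (L + n + 2) ^ b ≤ n ^ ((c + 2) * b) := by
    calc (L + n + 2) ^ b ≤ (n ^ (c + 2)) ^ b := Nat.pow_le_pow_left hsum b
      _ = n ^ ((c + 2) * b) := by rw [← pow_mul]
  have hlt : n ^ ((c + 2) * b) < n ^ ((c + 2) * b + 1) := Nat.pow_lt_pow_right (by omega) (by omega)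
  -- the multiplier is admissible for `CF^ult`
  have hv : padicValNat 2 M ≤ n ^ ((c + 2) * b + 1) := by
    have h1 : padicValNat 2 M ≤ Nat.log 2 M := padicValNat_le_nat_log M
    omega
  have hchain : n ^ ((c + 2) * b + 1) ≤ n ^ ((c + 2) * b) :=
    calc n ^ ((c + 2) * b + 1) ≤ constantFreeComplexity ((M : ℤ) • jet n k) := hτ M hM hv
      _ ≤ (L + n + 2) ^ b := hτM
      _ ≤ n ^ ((c + 2) * b) := hXb
  omega

/-! ### `CE^ult` from descent, the integral multiple (with `log M` recorded) and sign simulation -/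

/-- **`CE^ult` without multiplier removal**: `stub_algebraicDescent` (verbatim) and
`stub_signSimulation` (verbatim; both LANDED, p575059 / p575638) together with
`stub_integralMultiple'` — the registered `stub_integralMultiple` plus the conjunct
`Nat.log 2 M ≤ (Q.size + n + 2)^b₁` — give constant elimination up to a multiplier of polynomial
bit-length, exponent `b = b₁ b₂ + b₁`: `τ(M·J) ≤ (|P| + t + 2)^{b₂} ≤ X^{b₁ b₂}`,
`log₂ M ≤ X^{b₁}`, `X = |Q| + n + 2 ≤ L_ℂ(J) + n + 2`. [folklore] -/
theorem jetConstantElimUltimate_of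
    (hD : ∀ (σ : Type) (f : MvPolynomial σ ℤ),
      ∃ Q : Literature.Computability.AlgebraicComplexity.ArithCircuit (AlgebraicClosure ℚ) σ,
        Q.IsFanInTwo ∧
        Q.Computes (MvPolynomial.map (Int.castRingHom (AlgebraicClosure ℚ)) f) ∧
        Q.size ≤ Literature.Computability.AlgebraicComplexity.complexity
          (MvPolynomial.map (Int.castRingHom ℂ) f))
    (hI : let J := fun (n k : ℕ) => (∑ σ : Equiv.Perm (Fin n), MvPolynomial.C (((Equiv.Perm.sign σ : ℤˣ) : ℤ) * (((Finset.univ.filter (fun p : Fin n × Fin n => p.1 < p.2 ∧ σ p.2 < σ p.1)).card.choose k : ℕ) : ℤ)) * ∏ i : Fin n, MvPolynomial.X (σ i, i) : MvPolynomial (Fin n × Fin n) ℤ);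
      ∃ b₁ : ℕ, ∀ n k : ℕ, k ≤ Nat.log 2 n →
        ∀ Q : Literature.Computability.AlgebraicComplexity.ArithCircuit (AlgebraicClosure ℚ) (Fin n × Fin n),
          Q.IsFanInTwo →
          Q.Computes (MvPolynomial.map (Int.castRingHom (AlgebraicClosure ℚ)) (J n k)) →
          ∃ (P : Literature.Computability.AlgebraicComplexity.ArithCircuit ℤ (Fin n × Fin n)) (t M : ℕ),
            1 ≤ M ∧ P.IsFanInTwo ∧ P.Computes ((M : ℤ) • J n k) ∧
            ((∀ g ∈ P.gates, ∀ u ∈ g.args, ∀ c : ℤ, u = .const c → c.natAbs ≤ 2 ^ t) ∧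
              (∀ args : List (ℤ × Literature.Computability.AlgebraicComplexity.ArithCircuit.Operand ℤ (Fin n × Fin n)),
                Literature.Computability.AlgebraicComplexity.ArithCircuit.Gate.sum args ∈ P.gates →
                  ∀ a ∈ args, a.1.natAbs ≤ 2 ^ t) ∧
              (∀ c : ℤ, P.output = .const c → c.natAbs ≤ 2 ^ t)) ∧
            P.size + t + 2 ≤ (Q.size + n + 2) ^ b₁ ∧ Nat.log 2 M ≤ (Q.size + n + 2) ^ b₁)
    (hS : ∃ b₂ : ℕ, ∀ (σ : Type) (f : MvPolynomial σ ℤ)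
      (P : Literature.Computability.AlgebraicComplexity.ArithCircuit ℤ σ) (t : ℕ),
      P.IsFanInTwo → P.Computes f →
      ((∀ g ∈ P.gates, ∀ u ∈ g.args, ∀ c : ℤ, u = .const c → c.natAbs ≤ 2 ^ t) ∧
        (∀ args : List (ℤ × Literature.Computability.AlgebraicComplexity.ArithCircuit.Operand ℤ σ),
          Literature.Computability.AlgebraicComplexity.ArithCircuit.Gate.sum args ∈ P.gates →
            ∀ a ∈ args, a.1.natAbs ≤ 2 ^ t) ∧
        (∀ c : ℤ, P.output = .const c → c.natAbs ≤ 2 ^ t)) →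
      Literature.Computability.AlgebraicComplexity.constantFreeComplexity f ≤ (P.size + t + 2) ^ b₂) :
    ∃ b : ℕ, ∀ n k : ℕ, k ≤ Nat.log 2 n → ∃ M : ℕ, 1 ≤ M ∧
      Nat.log 2 M ≤ (complexity (MvPolynomial.map (Int.castRingHom ℂ) (jet n k)) + n + 2) ^ b ∧
      constantFreeComplexity ((M : ℤ) • jet n k) ≤
        (complexity (MvPolynomial.map (Int.castRingHom ℂ) (jet n k)) + n + 2) ^ b := by
  obtain ⟨b₁, hb₁⟩ := hI
  obtain ⟨b₂, hb₂⟩ := hS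
  refine ⟨b₁ * b₂ + b₁, fun n k hk => ?_⟩
  obtain ⟨Q, hQ2, hQc, hQs⟩ := hD (Fin n × Fin n) (jet n k)
  obtain ⟨P, t, M, hM, hP2, hPc, hPb, hPs, hlogM⟩ := hb₁ n k hk Q hQ2 hQc
  have hτM : constantFreeComplexity ((M : ℤ) • jet n k) ≤ (P.size + t + 2) ^ b₂ :=
    hb₂ (Fin n × Fin n) _ P t hP2 hPc hPb
  set L := complexity (MvPolynomial.map (Int.castRingHom ℂ) (jet n k)) with hL
  set X := Q.size + n + 2 with hX
  have hX1 : 1 ≤ X := by omega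
  have hXL : X ≤ L + n + 2 := by omega
  have hL1 : 1 ≤ L + n + 2 := by omega
  refine ⟨M, hM, ?_, ?_⟩
  · calc Nat.log 2 M ≤ X ^ b₁ := hlogM
      _ ≤ (L + n + 2) ^ b₁ := Nat.pow_le_pow_left hXL _
      _ ≤ (L + n + 2) ^ (b₁ * b₂ + b₁) := Nat.pow_le_pow_right hL1 (by omega)
  · calc constantFreeComplexity ((M : ℤ) • jet n k) ≤ (P.size + t + 2) ^ b₂ := hτM
      _ ≤ (X ^ b₁) ^ b₂ := Nat.pow_le_pow_left hPs _
      _ = X ^ (b₁ * b₂) := by rw [← pow_mul]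
      _ ≤ (L + n + 2) ^ (b₁ * b₂) := Nat.pow_le_pow_left hXL _
      _ ≤ (L + n + 2) ^ (b₁ * b₂ + b₁) := Nat.pow_le_pow_right hL1 (by omega)

/-! ### Where `stub_multiplierRemoval` sits between the two gluings -/

/-- **`CE^ult → MR → CE`** (exponent `(b + 2)·b₃`): the registered stub
`stub_multiplierRemoval` (verbatim) is exactly what turns constant elimination up to a multiplier
into constant elimination. [folklore] -/
theorem jetConstantElim_of_ultimate_of_multiplierRemoval
    (hCE : ∃ b : ℕ, ∀ n k : ℕ, k ≤ Nat.log 2 n → ∃ M : ℕ, 1 ≤ M ∧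
      Nat.log 2 M ≤ (complexity (MvPolynomial.map (Int.castRingHom ℂ) (jet n k)) + n + 2) ^ b ∧
      constantFreeComplexity ((M : ℤ) • jet n k) ≤
        (complexity (MvPolynomial.map (Int.castRingHom ℂ) (jet n k)) + n + 2) ^ b)
    (hR : let J := fun (n k : ℕ) => (∑ σ : Equiv.Perm (Fin n), MvPolynomial.C (((Equiv.Perm.sign σ : ℤˣ) : ℤ) * (((Finset.univ.filter (fun p : Fin n × Fin n => p.1 < p.2 ∧ σ p.2 < σ p.1)).card.choose k : ℕ) : ℤ)) * ∏ i : Fin n, MvPolynomial.X (σ i, i) : MvPolynomial (Fin n × Fin n) ℤ);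
      ∃ b₃ : ℕ, ∀ n k M : ℕ, k ≤ Nat.log 2 n → 1 ≤ M →
        Literature.Computability.AlgebraicComplexity.constantFreeComplexity (J n k) ≤
          (Literature.Computability.AlgebraicComplexity.constantFreeComplexity ((M : ℤ) • J n k) + n + 2) ^ b₃) :
    JetConstantElim := by
  obtain ⟨b, hb⟩ := hCE
  obtain ⟨b₃, hb₃⟩ := hR
  refine ⟨(b + 2) * b₃, fun n k hk => ?_⟩
  obtain ⟨M, hM, -, hτM⟩ := hb n k hk
  set L := complexity (MvPolynomial.map (Int.castRingHom ℂ) (jet n k)) with hL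
  have hX2 : 2 ≤ L + n + 2 := by omega
  -- `X^b + X ≤ X^(b+2)`
  have key : (L + n + 2) ^ b + (L + n + 2) ≤ (L + n + 2) ^ (b + 2) := by
    set X := L + n + 2 with hX
    have h1 : 1 ≤ X ^ b := Nat.one_le_pow _ _ (by omega)
    have h3 : X ^ b ≤ X ^ b * X := Nat.le_mul_of_pos_right _ (by omega)
    have h4 : X ≤ X ^ b * X := Nat.le_mul_of_pos_left _ h1
    calc X ^ b + X ≤ X ^ b * X + X ^ b * X := add_le_add h3 h4
      _ = X ^ b * X * 2 := by ring
      _ ≤ X ^ b * X * X := Nat.mul_le_mul_left _ hX2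
      _ = X ^ (b + 2) := by ring
  calc constantFreeComplexity (jet n k)
      ≤ (constantFreeComplexity ((M : ℤ) • jet n k) + n + 2) ^ b₃ := hb₃ n k M hk hM
    _ ≤ ((L + n + 2) ^ b + (L + n + 2)) ^ b₃ := Nat.pow_le_pow_left (by omega) _
    _ ≤ ((L + n + 2) ^ (b + 2)) ^ b₃ := Nat.pow_le_pow_left key _
    _ = (L + n + 2) ^ ((b + 2) * b₃) := by rw [← pow_mul]

/-- **`CE → CE^ult`** (take `M = 1`; `log₂ 1 = 0`). [folklore] -/
theorem jetConstantElimUltimate_of_jetConstantElim (hCE : JetConstantElim) :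
    ∃ b : ℕ, ∀ n k : ℕ, k ≤ Nat.log 2 n → ∃ M : ℕ, 1 ≤ M ∧
      Nat.log 2 M ≤ (complexity (MvPolynomial.map (Int.castRingHom ℂ) (jet n k)) + n + 2) ^ b ∧
      constantFreeComplexity ((M : ℤ) • jet n k) ≤
        (complexity (MvPolynomial.map (Int.castRingHom ℂ) (jet n k)) + n + 2) ^ b := by
  obtain ⟨b, hb⟩ := hCE
  refine ⟨b, fun n k hk => ⟨1, le_rfl, by simp, ?_⟩⟩
  rw [Nat.cast_one, one_smul]
  exact hb n k hk

/-- **`CF^ult → CF`** (take `M = 1`; `v₂(1) = 0`). [folklore] -/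
theorem cfGrowth_of_ultimate
    (hCF : ∀ c : ℕ, ∃ k : ℕ, 1 ≤ k ∧ ∀ n₀ : ℕ, ∃ n : ℕ, n₀ ≤ n ∧ ∀ M : ℕ, 1 ≤ M →
      padicValNat 2 M ≤ n ^ c → n ^ c ≤ constantFreeComplexity ((M : ℤ) • jet n k)) :
    ConstantFreeJetGrowth := by
  intro c
  obtain ⟨k, hk1, hk⟩ := hCF c
  refine ⟨k, hk1, fun n₀ => ?_⟩
  obtain ⟨n, hn, hM⟩ := hk n₀
  refine ⟨n, hn, ?_⟩
  have h := hM 1 le_rfl (by simp)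
  rwa [Nat.cast_one, one_smul] at h

end Summit.ValiantsHypothesis.ValiantsHypothesis.Theorems.AnyonJets.JetConstantElim

end
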